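/-
Copyright (c) 2026 the pub-hodgecm-mathlib formalisation cell (harness21).  Prover seat hodgecm-mathlib-K2E3-p32 (g0), HCML Track B «K2-LIT» (close-out strike line L4
`stub_StCharTS`), h413 = `stmt-HodgeConjecture-24833`, line `K2_E3_EllipticInputs`, unit U4 «Keys», PART «U4Keys» socket :155 (U4f-χ₁-ram-one-d0B)
`sig_K2E3KeysThmTwoContractingRamifiedCharOneDepthZeroNormTrivial` (LINE-LEAD K2E3-plan (g4) EMIT #5, deal D162, cell «U4-RAM»; plan of record K2E3-p06 (g4) DESIGN-M2-v2 (O2),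
step Z2-B «BRANCH B: det M = 0» — the generic ★ `K2E3BranchBDeterminantVanishing` READ ON `U(Φ₃)(L⁺_v)` over the cover ★ `cover_borel_I`).  2026-09-04.
-/
import Summits.HodgeConjecture.HodgeConjecture.Theorems.K2E3BranchBTypeBasisCM             -- ★ (this seat) the normalised `(I, χ̃)`-type basis exists in Branch B; brings the (G3)-frame, ★ `map_weyl_eq_weylLongU`, ★ `cover_borel_I` (p05), ★ MACKEY §4 `cover_two_of_cover_fin_two`
import Summits.HodgeConjecture.HodgeConjecture.Theorems.K2E3BranchBDeterminantVanishing   -- ★ (this seat) `det_intertwiningIntegral_eq_zero_of_typeVector` (generic Z2-B)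
import HarnessLib

/-!
# K2 ∕ E3 «EllipticInputs», unit U4 «Keys» — (U4f-χ₁-ram-one-d0B) step Z2-B ON `U(Φ₃)(L⁺_v)`: AN `(I, χ̃)`-TYPE VECTOR `f` WITH `f(1) ≠ 0`, `Λ_1 f = Λ_{w₀} f = 0` FORCES
# `det M = Λ_1 f₁ · Λ_{w₀} f_w − Λ_1 f_w · Λ_{w₀} f₁ = 0` FOR EVERY NORMALISED `(I, χ̃)`-TYPE BASIS `(f₁, f_w)` (given the integrability of the four cell integrals)
# [Casselman1980 §3; Casselman1995 §6.3–§6.4, Thm. 6.6.2; Keys1984 §3, §7 Thm (2); Roche1998 §3–§4; BruhatTits1972 (4.4.4)]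

Cell `pub/hodgecm-mathlib`, crux H413 = `stmt-HodgeConjecture-24833`, route of record `HCCMUnconditional`; chair K2-lead (g2), LINE-LEAD∕dealer K2E3-plan (g4), architect K2E3-p25
(g3); cell «U4-RAM».  THEOREMS ONLY (no `def`, no `instance`, no `notation`, no named-fact hypothesis, no `sorry`); lane `--supports stmt-HodgeConjecture-24833 --as helper`,
count-neutral.  NOT THE PAYER: the socket :155 stays OPEN (the four cell integrals and their values are the analytic core Z3; dyadic and ramified places).

THE POINT.  HYPOTHESIS-FIRST CM reading of the generic Z2-B brick ★ `K2E3BranchBDeterminantVanishing.det_intertwiningIntegral_eq_zero_of_typeVector` (this seat): on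
`G = U(Φ₃)(L⁺_v)` in the (G3)-EXPLICIT frame, with `H = P`, `τ = χ̃·δ^{1∕2}` (the inducing character of `i(χ₁, 1)`), `B = I` (the Iwahori level), `θ(b) = χ₁(b₀₀)` and the cover
`G = P·I ∪ P·w₀·I` — which is ★ `F0P3cStCharTSStLevelsPF.cover_borel_I` (K2E3-p05) read through `w̃ = eA⁻¹(w) = w₀` (★ `map_weyl_eq_weylLongU`) and ★ MACKEY §4
`cover_two_of_cover_fin_two` — ANY normalised `(I, χ̃)`-type basis `(f₁, f_w)` (`f₁(1) = 1, f₁(w₀) = 0, f_w(1) = 0, f_w(w₀) = 1`; it EXISTS in Branch B at depth zero, ★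
`K2E3BranchBTypeBasisCM`) with INTEGRABLE cell integrands `n ↦ fᵢ(w₀ n g)`, `g ∈ {1, w₀}`, and ANY `(I, χ̃)`-type vector `f` with `f(1) ≠ 0`, `Λ_1 f = Λ_{w₀} f = 0` (it EXISTS when
`i(χ₁, 1)` is reducible: ★ V1 → datum → ★ Z2A-2 → ★ V2b, the chain of ★ Z2A-5, filed branch-free as 📤 `K2E3TypeVectorInKernelDepthZeroCM`) give
**`(∫ f₁(w₀n))(∫ f_w(w₀nw₀)) − (∫ f_w(w₀n))(∫ f₁(w₀nw₀)) = 0`**: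
* **`det_intertwiningIntegral_eq_zero_of_typeVector`** (CM, frame letters; no hypothesis on `χ₁` beyond the letters' shapes).
Downstream (PAPER-Z3 DepthZeroInert §1–§3): the entries are `G₁, vol N₀, vol N(𝔭), G₂` (Z3, analytic, open), ★ Z3-d∕Z4 `K2E3BranchBDeterminantRoots` (`det = 0 ⟺ Y = −1∕q` on
`|Y| < 1`) and ★ Z5 `K2E3KeysThmTwoDepthZeroBranchBConversion` (this seat) turn `det M = 0` into Keys (b)–(d) at an inert place.
HONEST LABEL.  HC_CM is proved only modulo the 7 printed citations (2 remaining named inputs: hLiu418 = `stmt-HodgeConjecture-24832`, h413 = `stmt-HodgeConjecture-24833`) until rung 0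
closes; count-neutral — this file does NOT pay the leaf; no printed citation is discharged.

## References
* [Casselman1980] W. Casselman, Compositio Math. 40 (1980), §3 (the functionals on the Iwahori-type vectors and their matrix).
* [Casselman1995] W. Casselman, *Introduction to the theory of admissible representations of `p`-adic reductive groups* (1995), §6.3–§6.4, Thm. 6.6.2.
* [Keys1984] D. Keys, Compositio Math. 51 (1984), §3, §7 Theorem (2) p. 126.
* [Roche1998] A. Roche, Ann. Sci. ÉNS (4) 31 (1998), §3–§4.
* [BruhatTits1972] F. Bruhat, J. Tits, Publ. Math. IHÉS 41 (1972), (4.4.4).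
-/

set_option autoImplicit false
-- the mandated namespace has the single-problem summit's repeated segment (`HodgeConjecture.HodgeConjecture`)
set_option linter.dupNamespace false

noncomputable section

open NumberField IsDedekindDomain MeasureTheory
open scoped Matrix MatrixGroups WithZero Valued
open Literature.NumberTheory Literature.NumberTheory.Automorphic Literature.NumberTheory.Automorphic.UnitaryGroup
open Literature.NumberTheory.Rogawski1990

namespace Summit.HodgeConjecture.HodgeConjecture.Cruxes.H413.K2E3BranchBDeterminantZeroDepthZero

open Summit.HodgeConjecture.HodgeConjecture.Cruxes.H413
open Summit.HodgeConjecture.HodgeConjecture.Cruxes.H413.K2E3DepthZeroIwahoriCharacterCM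
open Summit.HodgeConjecture.HodgeConjecture.Cruxes.H413.K2E3BranchATorusWitnessCM
open Summit.HodgeConjecture.HodgeConjecture.Cruxes.H413.K2E3BranchATypeLettersCM

variable (L : Type) [Field L] [NumberField L] [IsCMField L] (v : HeightOneSpectrum (𝓞 ↥(maximalRealSubfield L)))
  (w : PlacesOver L v) (hw : IsCMField.complexConj L • w.1 = w.1)
  (eA : Gqs L v ≃ₜ* ↥(unitaryGroupOfForm (galAdicCompletionMap (L := L) (IsCMField.complexConj L) hw) ((StdForm.antidiagonal 3).over (w.1.adicCompletion L))))
  (heA : ∀ g : Gqs L v,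
    ((eA g : ↥(unitaryGroupOfForm (galAdicCompletionMap (L := L) (IsCMField.complexConj L) hw) ((StdForm.antidiagonal 3).over (w.1.adicCompletion L)))) :
        GL (Fin 3) (w.1.adicCompletion L)) =
      ((localNonsplitEquiv (IsCMField.complexConj L) (qsForm L) (IsCMField.complexConj_ne_one L) w hw g :
        ↥(unitaryGroupOfForm (galAdicCompletionMap (L := L) (IsCMField.complexConj L) hw) (placeForm (qsForm L) w.1))) : GL (Fin 3) (w.1.adicCompletion L)))
  {ϖ : w.1.adicCompletion L} (hϖ : Valued.v ϖ = WithZero.exp (-1 : ℤ))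
  (g₁ : GL (Fin 3) (w.1.adicCompletion L)) (hg₁ : (g₁ : Matrix (Fin 3) (Fin 3) (w.1.adicCompletion L)) = Matrix.diagonal ![(1 : w.1.adicCompletion L), 1, ϖ])
  (K0 K1 I : Subgroup (Gqs L v))
  (hK0 : K0 = ((glInt 3 (w.1.adicCompletion L)).subgroupOf
    (unitaryGroupOfForm (galAdicCompletionMap (L := L) (IsCMField.complexConj L) hw) ((StdForm.antidiagonal 3).over (w.1.adicCompletion L)))).comap
      eA.toMulEquiv.toMonoidHom)
  (hK1 : K1 = (((glInt 3 (w.1.adicCompletion L)).map (MulAut.conj g₁).toMonoidHom).subgroupOf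
    (unitaryGroupOfForm (galAdicCompletionMap (L := L) (IsCMField.complexConj L) hw) ((StdForm.antidiagonal 3).over (w.1.adicCompletion L)))).comap
      eA.toMulEquiv.toMonoidHom)
  (hI : I = K0 ⊓ K1)

/-! ## `det M = 0` from a type vector killed by `Λ_1` and `Λ_{w₀}`, on `U(Φ₃)(L⁺_v)` -/

open Classical in
include hw heA hϖ hg₁ hK0 hK1 hI in
set_option maxHeartbeats 8000000 in
set_option synthInstance.maxHeartbeats 400000 in
-- the `SmoothInd` carrier on `U(Φ₃)(L⁺_v)` and the generic Z2-B brick (class of ★ `K2E3BranchBTypeBasisCM`)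
/-- **`det M = 0` ON `U(Φ₃)(L⁺_v)` (step Z2-B, hypothesis-first).**  In the (G3)-frame with `w₀` the element of matrix `Φ₃` and `μ` any measure on `N(L⁺_v)`: let `(f₁, f_w)` be
a normalised `(I, χ̃)`-type basis of `i(χ₁, 1)` (`b·fᵢ = χ₁(b₀₀)·fᵢ` on `I`; `f₁(1) = 1, f₁(w₀) = 0, f_w(1) = 0, f_w(w₀) = 1`) whose four cell integrands `n ↦ fᵢ(w₀ n g)`,
`g ∈ {1, w₀}`, are `μ`-integrable, and `f` an `(I, χ̃)`-type vector with `f(1) ≠ 0` and `∫_N f(w₀ n) dμ = ∫_N f(w₀ n w₀) dμ = 0`.  Then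
`(∫ f₁(w₀n·1))(∫ f_w(w₀nw₀)) − (∫ f_w(w₀n·1))(∫ f₁(w₀nw₀)) = 0` — ★ `K2E3BranchBDeterminantVanishing.det_intertwiningIntegral_eq_zero_of_typeVector` over the cover
`G = P·I ∪ P·w₀·I` (★ `cover_borel_I` with `w̃ = eA⁻¹w = w₀`, ★ `map_weyl_eq_weylLongU`, ★ `cover_two_of_cover_fin_two`). [cite: Casselman1980, §3] [cite: Casselman1995, §6.3–§6.4, Thm. 6.6.2]
[cite: Keys1984, §3, §7 Theorem (2) p. 126] [cite: Roche1998, §3–§4] [cite: BruhatTits1972, (4.4.4)] -/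
theorem det_intertwiningIntegral_eq_zero_of_typeVector (χ₁ : (LocalRing L v)ˣ →* ℂˣ)
    (w₀ : ↥(unitaryGroupOfForm (conjLocal L (IsCMField.complexConj L) v) (cmLocalForm L 3 v))) (hw₀ : Units.val (w₀ : GL (Fin 3) (LocalRing L v)) = cmLocalForm L 3 v)
    [MeasurableSpace ↥(cmBorelTriple L 3 v).N] (μ : Measure ↥(cmBorelTriple L 3 v).N)
    (f₁ f_w : haveI := locallyCompactSpace_cmBorelU L 3 v
      Representation.SmoothInd (cmBorelTriple L 3 v).P
        (Representation.twist (((Representation.trivial ℂ ↥(torusU (conjLocal L (IsCMField.complexConj L) v) (cmLocalForm L 3 v)) ℂ).twist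
          (cmTorusCharPair L v χ₁ 1)).comp (cmBorelTriple L 3 v).proj) (rootDeltaChar (cmBorelTriple L 3 v).P)))
    (heig₁ : ∀ x ∈ I, (haveI := locallyCompactSpace_cmBorelU L 3 v; Representation.smoothIndRep _ _ x f₁) = (if h : IsUnit (((x.val : GL (Fin 3) (LocalRing L v)) : Matrix (Fin 3) (Fin 3) (LocalRing L v)) 0 0) then ((χ₁ h.unit : ℂˣ) : ℂ) else 0) • f₁)
    (heig_w : ∀ x ∈ I, (haveI := locallyCompactSpace_cmBorelU L 3 v; Representation.smoothIndRep _ _ x f_w) = (if h : IsUnit (((x.val : GL (Fin 3) (LocalRing L v)) : Matrix (Fin 3) (Fin 3) (LocalRing L v)) 0 0) then ((χ₁ h.unit : ℂˣ) : ℂ) else 0) • f_w)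
    (h11 : f₁.toFun 1 = 1) (h1g : f₁.toFun w₀ = 0) (hw1 : f_w.toFun 1 = 0) (hwg : f_w.toFun w₀ = 1)
    (hi₁₁ : Integrable (fun n : ↥(cmBorelTriple L 3 v).N => f₁.toFun (w₀ * (n : ↥(unitaryGroupOfForm (conjLocal L (IsCMField.complexConj L) v) (cmLocalForm L 3 v))) * 1)) μ)
    (hiw₁ : Integrable (fun n : ↥(cmBorelTriple L 3 v).N => f_w.toFun (w₀ * (n : ↥(unitaryGroupOfForm (conjLocal L (IsCMField.complexConj L) v) (cmLocalForm L 3 v))) * 1)) μ)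
    (hi₁₂ : Integrable (fun n : ↥(cmBorelTriple L 3 v).N => f₁.toFun (w₀ * (n : ↥(unitaryGroupOfForm (conjLocal L (IsCMField.complexConj L) v) (cmLocalForm L 3 v))) * w₀)) μ)
    (hiw₂ : Integrable (fun n : ↥(cmBorelTriple L 3 v).N => f_w.toFun (w₀ * (n : ↥(unitaryGroupOfForm (conjLocal L (IsCMField.complexConj L) v) (cmLocalForm L 3 v))) * w₀)) μ)
    (f : haveI := locallyCompactSpace_cmBorelU L 3 v
      Representation.SmoothInd (cmBorelTriple L 3 v).P
        (Representation.twist (((Representation.trivial ℂ ↥(torusU (conjLocal L (IsCMField.complexConj L) v) (cmLocalForm L 3 v)) ℂ).twist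
          (cmTorusCharPair L v χ₁ 1)).comp (cmBorelTriple L 3 v).proj) (rootDeltaChar (cmBorelTriple L 3 v).P)))
    (heig : ∀ x ∈ I, (haveI := locallyCompactSpace_cmBorelU L 3 v; Representation.smoothIndRep _ _ x f) = (if h : IsUnit (((x.val : GL (Fin 3) (LocalRing L v)) : Matrix (Fin 3) (Fin 3) (LocalRing L v)) 0 0) then ((χ₁ h.unit : ℂˣ) : ℂ) else 0) • f)
    (hf1 : f.toFun 1 ≠ 0)
    (hΛ₁ : ∫ n : ↥(cmBorelTriple L 3 v).N, f.toFun (w₀ * (n : ↥(unitaryGroupOfForm (conjLocal L (IsCMField.complexConj L) v) (cmLocalForm L 3 v))) * 1) ∂μ = 0)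
    (hΛ₂ : ∫ n : ↥(cmBorelTriple L 3 v).N, f.toFun (w₀ * (n : ↥(unitaryGroupOfForm (conjLocal L (IsCMField.complexConj L) v) (cmLocalForm L 3 v))) * w₀) ∂μ = 0) :
    (∫ n : ↥(cmBorelTriple L 3 v).N, f₁.toFun (w₀ * (n : ↥(unitaryGroupOfForm (conjLocal L (IsCMField.complexConj L) v) (cmLocalForm L 3 v))) * 1) ∂μ) * (∫ n : ↥(cmBorelTriple L 3 v).N, f_w.toFun (w₀ * (n : ↥(unitaryGroupOfForm (conjLocal L (IsCMField.complexConj L) v) (cmLocalForm L 3 v))) * w₀) ∂μ) -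
      (∫ n : ↥(cmBorelTriple L 3 v).N, f_w.toFun (w₀ * (n : ↥(unitaryGroupOfForm (conjLocal L (IsCMField.complexConj L) v) (cmLocalForm L 3 v))) * 1) ∂μ) * (∫ n : ↥(cmBorelTriple L 3 v).N, f₁.toFun (w₀ * (n : ↥(unitaryGroupOfForm (conjLocal L (IsCMField.complexConj L) v) (cmLocalForm L 3 v))) * w₀) ∂μ) = 0 := by
  haveI := locallyCompactSpace_cmBorelU L 3 v
  -- the structural instances of the carrier, synthesised once (class of ★ `K2E3BranchBTypeBasisCM`)
  haveI hTG : IsTopologicalGroup ↥(unitaryGroupOfForm (conjLocal L (IsCMField.complexConj L) v) (cmLocalForm L 3 v)) := inferInstance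
  -- the cover `G = P·I ∪ P·w₀·I`: ★ `cover_borel_I` with `w̃ = eA⁻¹(w) = w₀`
  have hwt : eA.symm (weylLongU (galAdicCompletionMap (L := L) (IsCMField.complexConj L) hw) (rfl : (StdForm.antidiagonal 3).over (w.1.adicCompletion L) = _)) = w₀ := by
    rw [← map_weyl_eq_weylLongU L v w hw eA heA w₀ hw₀, ContinuousMulEquiv.symm_apply_apply]
  have hcover' := F0P3cStCharTSStLevelsPF.cover_borel_I L v w hw eA heA hϖ g₁ hg₁ K0 K1 I hK0 hK1 hI
  rw [hwt] at hcover'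
  have hcover := K2E3IwahoriTypeBasisMackey.cover_two_of_cover_fin_two (cmBorelTriple L 3 v).P I w₀ hcover'
  -- the generic Z2-B brick, `@`-form (instances explicit, so that the `Gqs L v`-spelled letters are accepted by definitional unfolding)
  exact @K2E3BranchBDeterminantVanishing.det_intertwiningIntegral_eq_zero_of_typeVector _ _ _ hTG (cmBorelTriple L 3 v).P _ I
    (fun g : ↥(unitaryGroupOfForm (conjLocal L (IsCMField.complexConj L) v) (cmLocalForm L 3 v)) =>
      if h : IsUnit (((g : GL (Fin 3) (LocalRing L v)) : Matrix (Fin 3) (Fin 3) (LocalRing L v)) 0 0) then ((χ₁ h.unit : ℂˣ) : ℂ) else 0)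
    w₀ hcover (cmBorelTriple L 3 v).N _ μ w₀ 1 w₀ f₁ f_w heig₁ heig_w h11 h1g hw1 hwg hi₁₁ hiw₁ hi₁₂ hiw₂ f heig hf1 hΛ₁ hΛ₂

end Summit.HodgeConjecture.HodgeConjecture.Cruxes.H413.K2E3BranchBDeterminantZeroDepthZero

end
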